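import Summits.KontsevichZagierPeriods.KontsevichZagierPeriods.Theorems.SoloInformedKZChainFree
import HarnessLib
import HarnessLib.Audit

/-!
# SoloInformed — honest chains without catalyst, III: the empty-domain proviso is necessary

Solo programme `solo-KontsevichZagierPeriods-informed`, session s262 (file 5; THEOREM CH,
complement).

`SoloInformedKZChainFree` proved: for representations with NONEMPTY domains,
`KZ.Equivalent r r' ↔ {r} ~ {r'}` by honest moves, and the summit is equivalent to the
honest-chain statement for rational representations with nonempty domains.  Here we show that the
proviso cannot be dropped: honest moves preserve the property "the family contains a
representation with nonempty domain" (`soloInformed_chain_hasPt_iff`), so the anchor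
`P₀ = [ℝ⁰, 0]` and the empty representation `[∅ ⊆ ℝ⁰, 0]` — both rational, both of value `0`,
and `KZ.Equivalent` (both are relations) — are NOT connected by any chain of honest moves
(`soloInformed_not_chain_anchor_empty`).  Consequently the catalyst-free honest-chain reading of
the period conjecture WITHOUT the nonemptiness proviso is false outright
(`soloInformed_not_honestChains_without_proviso`), while the `ℤ`-span reading (the summit
statement) absorbs empty domains through the group law.  This is the precise (and only) point
where "`[r] − [r'] ∈ ℤ`-span of the moves" and "pass from `r` to `r'` by the rules" differ.

References: [Kontsevich–Zagier 2001, §1.2]; this work (`VERDICT.md` §1).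
-/

noncomputable section

namespace Summit.KontsevichZagierPeriods.KontsevichZagierPeriods.Theorems

open Set MeasureTheory
open Literature.ModelTheory.ExponentialFields
open Literature.NumberTheory.Transcendental Literature.NumberTheory.Transcendental.KZ

/-! ### The invariant: some member has nonempty domain -/

/-- A finite family of representations HAS A POINT if one of its members has nonempty domain.
[this work] -/
def SoloInformedHasPt (x : Multiset (Σ n, IntegralRep n)) : Prop :=
  ∃ a ∈ x, a.2.domain.Nonempty

/-- A singleton family has a point iff its member has nonempty domain. [folklore] -/
theorem soloInformed_hasPt_singleton (a : Σ n, IntegralRep n) :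
    SoloInformedHasPt {a} ↔ a.2.domain.Nonempty := by
  simp [SoloInformedHasPt]

/-- A two-element family has a point iff one of its members has nonempty domain. [folklore] -/
theorem soloInformed_hasPt_pair (a b : Σ n, IntegralRep n) :
    SoloInformedHasPt {a, b} ↔ a.2.domain.Nonempty ∨ b.2.domain.Nonempty := by
  simp [SoloInformedHasPt]

/-- A sum of families has a point iff one of the summands has. [folklore] -/
theorem soloInformed_hasPt_add (x y : Multiset (Σ n, IntegralRep n)) :
    SoloInformedHasPt (x + y) ↔ SoloInformedHasPt x ∨ SoloInformedHasPt y := by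
  simp only [SoloInformedHasPt, Multiset.mem_add]
  constructor
  · rintro ⟨a, ha | ha, hne⟩
    · exact Or.inl ⟨a, ha, hne⟩
    · exact Or.inr ⟨a, ha, hne⟩
  · rintro (⟨a, ha, hne⟩ | ⟨a, ha, hne⟩)
    · exact ⟨a, Or.inl ha, hne⟩
    · exact ⟨a, Or.inr ha, hne⟩

/-- The band of move (3) over `τ` is nonempty iff `τ` is (for `a ≤ b` on `τ`). [folklore] -/
theorem soloInformed_band_nonempty_iff {n : ℕ} {τ : Set (Fin n → ℝ)} {a b : (Fin n → ℝ) → ℝ}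
    (hab : ∀ x ∈ τ, a x ≤ b x) :
    {z : Fin (n + 1) → ℝ | Fin.init z ∈ τ ∧ a (Fin.init z) ≤ z (Fin.last n) ∧
      z (Fin.last n) ≤ b (Fin.init z)}.Nonempty ↔ τ.Nonempty := by
  constructor
  · rintro ⟨z, hz, -, -⟩
    exact ⟨Fin.init z, hz⟩
  · rintro ⟨x, hx⟩
    refine ⟨Fin.snoc x (a x), ?_⟩
    simp only [mem_setOf_eq, Fin.init_snoc, Fin.snoc_last]
    exact ⟨hx, le_rfl, hab x hx⟩

/-- **Each honest step preserves "has a point".** (1a): `σ = σ₁ ∪ σ₂`; (1b): equal domains;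
(2): `Φ '' σ`; (3): the band over `τ` with `a ≤ b`. [this work] -/
theorem soloInformed_step_hasPt_iff
    {p : Multiset (Σ n, IntegralRep n) × Multiset (Σ n, IntegralRep n)}
    (hp : p ∈ soloInformedKZSteps) : SoloInformedHasPt p.1 ↔ SoloInformedHasPt p.2 := by
  rcases hp with ((h | h) | h) | h
  · obtain ⟨n, r, r₁, r₂, h1, -, -, -, rfl⟩ := h
    rw [soloInformed_hasPt_singleton, soloInformed_hasPt_pair]
    show r.domain.Nonempty ↔ r₁.domain.Nonempty ∨ r₂.domain.Nonempty
    rw [h1, union_nonempty]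
  · obtain ⟨n, r, r₁, r₂, h1, h2, -, rfl⟩ := h
    rw [soloInformed_hasPt_singleton, soloInformed_hasPt_pair]
    show r.domain.Nonempty ↔ r₁.domain.Nonempty ∨ r₂.domain.Nonempty
    rw [h1, h2, or_self]
  · obtain ⟨n, r, r', Φ, Φ', -, -, -, h4, -, rfl⟩ := h
    rw [soloInformed_hasPt_singleton, soloInformed_hasPt_singleton]
    show r.domain.Nonempty ↔ r'.domain.Nonempty
    rw [h4, image_nonempty]
  · obtain ⟨n, r, r', a, b, F, -, -, -, h4, h5, -, -, -, rfl⟩ := h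
    rw [soloInformed_hasPt_singleton, soloInformed_hasPt_singleton]
    show r.domain.Nonempty ↔ r'.domain.Nonempty
    rw [h5, soloInformed_band_nonempty_iff h4]

/-- **Honest chains preserve "has a point".** [this work] -/
theorem soloInformed_chain_hasPt_iff {x y : Multiset (Σ n, IntegralRep n)}
    (h : SoloInformedMoveChain soloInformedKZSteps x y) :
    SoloInformedHasPt x ↔ SoloInformedHasPt y := by
  induction h with
  | of a b hab => exact soloInformed_step_hasPt_iff hab
  | refl a => exact Iff.rfl
  | symm _ ih => exact ih.symm
  | trans _ _ ih₁ ih₂ => exact ih₁.trans ih₂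
  | add _ _ ih₁ ih₂ =>
    rw [soloInformed_hasPt_add, soloInformed_hasPt_add]
    exact or_congr ih₁ ih₂

/-! ### The separating pair -/

/-- **The empty representation** `[∅ ⊆ ℝ⁰, 0]`. [Kontsevich–Zagier 2001, §1.1] -/
def soloInformedEmptyRep : IntegralRep 0 :=
  soloInformedZRep ∅ isSemialgebraic_empty

/-- The anchor and the empty representation are `KZ.Equivalent` (both are relations).
[Kontsevich–Zagier 2001, §1.2] -/
theorem soloInformed_equivalent_anchor_empty : Equivalent soloInformedAnchor soloInformedEmptyRep :=
  relations.sub_mem (soloInformed_of_zrep_mem_relations _ _)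
    (soloInformed_of_mem_relations_of_domain_empty _ rfl)

/-- **No honest chain connects the anchor to the empty representation.** [this work] -/
theorem soloInformed_not_chain_anchor_empty :
    ¬ SoloInformedMoveChain soloInformedKZSteps
      ({(⟨0, soloInformedAnchor⟩ : Σ n, IntegralRep n)} : Multiset (Σ n, IntegralRep n))
      {(⟨0, soloInformedEmptyRep⟩ : Σ n, IntegralRep n)} := by
  intro h
  have h1 : SoloInformedHasPt {(⟨0, soloInformedAnchor⟩ : Σ n, IntegralRep n)} :=
    (soloInformed_hasPt_singleton _).2 soloInformedAnchor_domain_nonempty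
  have h2 := (soloInformed_hasPt_singleton _).1 ((soloInformed_chain_hasPt_iff h).1 h1)
  exact not_nonempty_empty h2

/-- **The nonemptiness proviso of `soloInformed_summit_iff_honestChains` cannot be dropped**: the
catalyst-free honest-chain statement for ALL rational representations is false (witness: the
anchor `[ℝ⁰, 0]` and `[∅, 0]`, both rational of value `0`). [this work] -/
theorem soloInformed_not_honestChains_without_proviso :
    ¬ ∀ ⦃n m : ℕ⦄ (r : IntegralRep n) (r' : IntegralRep m), r.IsRational → r'.IsRational →
        r.value = r'.value →
        SoloInformedMoveChain soloInformedKZSteps {(⟨n, r⟩ : Σ n, IntegralRep n)}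
          {(⟨m, r'⟩ : Σ n, IntegralRep n)} := by
  intro H
  refine soloInformed_not_chain_anchor_empty (H soloInformedAnchor soloInformedEmptyRep
    (soloInformedZRep_isRational _ _) (soloInformedZRep_isRational _ _) ?_)
  rw [soloInformedAnchor, soloInformedEmptyRep, soloInformedZRep_value, soloInformedZRep_value]

/-- **Summary (THEOREM CH).**  (i) `KZ.Equivalent r r' ↔ ∃ t, {r} + t ~ {r'} + t`
(all representations); (ii) for nonempty domains the catalyst is removable:
`KZ.Equivalent r r' ↔ {r} ~ {r'}`; (iii) with an empty domain it is not: `P₀`, `[∅, 0]` are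
equivalent but not chain-connected. [this work] -/
theorem soloInformed_theoremCH_summary :
    (∀ ⦃n m : ℕ⦄ (r : IntegralRep n) (r' : IntegralRep m), Equivalent r r' ↔
        ∃ t : Multiset (Σ n, IntegralRep n), SoloInformedMoveChain soloInformedKZSteps
          ({(⟨n, r⟩ : Σ n, IntegralRep n)} + t) ({(⟨m, r'⟩ : Σ n, IntegralRep n)} + t)) ∧
    (∀ ⦃n m : ℕ⦄ (r : IntegralRep n) (r' : IntegralRep m), r.domain.Nonempty →
        r'.domain.Nonempty → (Equivalent r r' ↔ SoloInformedMoveChain soloInformedKZSteps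
          {(⟨n, r⟩ : Σ n, IntegralRep n)} {(⟨m, r'⟩ : Σ n, IntegralRep n)})) ∧
    (Equivalent soloInformedAnchor soloInformedEmptyRep ∧
      ¬ SoloInformedMoveChain soloInformedKZSteps
        ({(⟨0, soloInformedAnchor⟩ : Σ n, IntegralRep n)} : Multiset (Σ n, IntegralRep n))
        {(⟨0, soloInformedEmptyRep⟩ : Σ n, IntegralRep n)}) :=
  ⟨fun _ _ r r' => soloInformed_equivalent_iff_exists_chain r r',
    fun _ _ _ _ hr hr' => soloInformed_equivalent_iff_chain hr hr',
    soloInformed_equivalent_anchor_empty, soloInformed_not_chain_anchor_empty⟩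

end Summit.KontsevichZagierPeriods.KontsevichZagierPeriods.Theorems
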